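import Summits.HodgeConjecture.HodgeConjecture.Theorems.F0P3cStCharTSJetAtDatum      -- ★ J2 p853206∕p853398: `twist_comp_proj_unipotentModel_apply` + the CM jet datum (brings ★ J1, ★ `UnitaryGroupBorelInduction`)
import Literature.NumberTheory.Automorphic.CMPrincipalSeriesJacquetEvalOne              -- ★ `nonarchimedeanGroup_cmLocal`, `continuous_proj_borelTriple`, `continuous_apply_proj_borelTriple` (brings ★ (L-q) `SmoothIndClosedCellNonzero` §6)
import Literature.NumberTheory.Automorphic.CMBorelWeylTorusConjugate                  -- ★ T3b `weylConj_mem_cmTorus`, `cmTorusCharPair_weylConj`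
import HarnessLib

/-!
# (O1)-D — THE WEYL DOCK OF THE JET DATUM: `N₀⁺(ʷm) = N₀⁻(m)` and the open fixer of `i_B(N₀⁺)`'s inducing data

Cell `pub/hodgecm-mathlib`, crux H413 = `stmt-HodgeConjecture-24833` (`--supports … --as helper`, THEOREMS ONLY: no definition ∕ instance ∕ notation ∕ named fact ∕ `sorry`).
Namespace `Summit.HodgeConjecture.HodgeConjecture.Cruxes.H413.F0P3cStCharTSJetDatumWeylDock`.  E1 BRICK LEDGER (keeper F0P3a-p03 (g31), k12) row «(O1)-D», cut by the (O1)
pen F0P2-p02 (g27) 2026-09-03T05:16:03Z: the two CONSUMER-SIDE obligations CENSUS-O2 v1 e769acda §1 leaves out of FILE B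
`Theorems/F0P3U3PrincipalSeriesOpenCellSigmaTwist.lean` (LH5-p05 (g13)), namely the identification `(N₀⁺)^{w₀} = N₀⁻` of the Weyl-conjugated jet datum and the smoothness
(open fixer) of the inducing datum `N₀⁺ ∘ proj ⊗ δ_B^{1∕2}` — so that FILE B's (B2)+(B4) at `σ := N₀⁺` dock into the (O1) head `Theorems/F0P3cStCharTSK4PrimeJetIntertwiner.lean`'s
`hGL` letters (`hGL` TEXT v1 bd2c149c: `N₀ N₀' hN₀ hN₀' ℓ hℓ θ hθM hθE`).

WHAT IS PROVED (letters of ★ J2 `F0P3cStCharTSJetAtDatum` VERBATIM: `σ₀ : Representation ℂ ↥t.M W`, `lam : ↥t.M → ℂ`, the LOWER-TRIANGULAR jets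
`N₀ m (w₁, w₂) = (σ₀ m w₁, λ(m) σ₀ m w₁ + σ₀ m w₂)` (`hN₀`) and `N₀' m (w₁, w₂) = (σ₀ m w₁, −λ(m) σ₀ m w₁ + σ₀ m w₂)` (`hN₀'`, the (O1) pen's `N₀'`)):
* §1 (any group, pure algebra) **`unipotentModel_apply_weylConj_eq`**: for any self-map `wm` of `t.M` with `σ₀ ∘ wm = σ₀` («`χ^w = χ`») and `λ ∘ wm = −λ` («`λ^w = −λ`»),
  `N₀ (wm m) = N₀' m` — the one `rw` that turns FILE B (B2)'s `σ(ʷm)` (at `σ := N₀`) into `hθM`'s right-hand side `N₀' m`; character spelling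
  `unipotentModel_char_apply_weylConj_eq` (`χ₁ m x = χ m · x`, hypothesis `χ (wm m) = χ m`, the `hGL` TEXT's `χ χ₁ hχ₁`).
* §2 (any topological group, any parabolic triple) **`exists_isOpen_forall_twist_unipotentModel_apply_eq`**: if the inducing datum `σ₀ ∘ proj ⊗ δ^{1∕2}` fixes the two
  coordinates of `w = (w₁, w₂)` on `P ∩ K₁` and `λ ∘ proj` vanishes on `P ∩ K₂` (`K₁, K₂` open subgroups), then `N₀ ∘ proj ⊗ δ^{1∕2}` fixes `w` on `P ∩ (K₁ ⊓ K₂)` — FILE B (B2)'s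
  per-vector open-fixer hypothesis `hσ` at `σ := N₀` (★ J2 `twist_comp_proj_unipotentModel_apply`).
* §3 (the CM datum `G = U(Φ₃)(L⁺_v)`, `t := cmBorelTriple L 3 v`): `hσK` for a CONTINUOUS character `χ` of `T(L⁺_v)` is ★ (L-q) §6
  `exists_isOpen_forall_twist_comp_proj_eq_one` (`B` closed, `K_v` compact open, `G` non-archimedean); `hlamK` for a `λ` VANISHING ON AN OPEN SUBGROUP `K_M ≤ T` (every additive
  character occurring in a smooth Jacquet module does) — **`exists_isOpen_forall_lam_proj_eq_zero`** (`proj` continuous on `B`, `G` non-archimedean); assembled: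
  **`exists_isOpen_forall_twist_unipotentModel_char_apply_eq_cm`** = FILE B's `hσ` for the jet datum of `(χ, λ)`, every `w : ℂ × ℂ`.  The Weyl self-map at the datum is
  `m ↦ ⟨w₀ m w₀⁻¹, weylConj_mem_cmTorus …⟩` (★ T3b), whence **`unipotentModel_char_apply_cmWeylConj_eq`**: `N₀ ⟨w₀ m w₀⁻¹, _⟩ = N₀' m` from `χ(ʷm) = χ(m)` and `λ(ʷm) = −λ(m)`
  (both hypotheses: the K4′ datum's «`χ^w = χ`» [Rogawski1990 §12.2 (3)] and the rank-one sign flip of the occurring additive character, supplied by the (O1) file's `hrank` road).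
HONEST LABEL: count-neutral dock; K4′ = SHRINK candidate only when (O1)+(O2) are ★ and the K4′ head closes (rule 25∕26, LEAD F0P3a-plan); E1 = PRINT; h413 OPEN; HC_CM is proved only
modulo the 7 printed citations (2 remaining named inputs hLiu418 = stmt-HodgeConjecture-24832, h413 = stmt-HodgeConjecture-24833) until rung 0 closes.

## References
* [BernsteinZelevinsky1977] I. N. Bernstein, A. V. Zelevinsky, Ann. Sci. ÉNS 10 (1977), §1.9, §2.3, Geometrical Lemma 2.12.
* [Casselman1995] W. Casselman, *Introduction to the theory of admissible representations of `p`-adic reductive groups* (1995), §6.3, Lemma 7.1.1 (a).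
* [Keys1984] D. Keys, Compositio Math. 51 (1984), §3 pp. 118–119.
* [Rogawski1990] J. Rogawski, Ann. of Math. Stud. 123 (1990), §12.2 (3) p. 173.
-/

set_option autoImplicit false
-- the mandated namespace has the single-problem summit's repeated segment (`HodgeConjecture.HodgeConjecture`)
set_option linter.dupNamespace false

noncomputable section

open NumberField IsDedekindDomain
open Literature.NumberTheory.Automorphic Literature.NumberTheory.Automorphic.UnitaryGroup Representation
open Summit.HodgeConjecture.HodgeConjecture.Cruxes.H413.F0P3cStCharTSJetAtDatum

namespace Summit.HodgeConjecture.HodgeConjecture.Cruxes.H413.F0P3cStCharTSJetDatumWeylDock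

/-! ## §1 The Weyl flip of the jet: `N₀⁺ ∘ wm = N₀⁻` (pure algebra) -/

section Flip

variable {M : Type*} [Group M] {W : Type*} [AddCommGroup W] [Module ℂ W]
  (σ₀ : Representation ℂ M W) (lam : M → ℂ) (N₀ N₀' : Representation ℂ M (W × W))
  (hN₀ : ∀ (m : M) (w : W × W), N₀ m w = (σ₀ m w.1, lam m • σ₀ m w.1 + σ₀ m w.2))
  (hN₀' : ∀ (m : M) (w : W × W), N₀' m w = (σ₀ m w.1, (-lam m) • σ₀ m w.1 + σ₀ m w.2))

include hN₀ hN₀' in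
/-- **THE WEYL FLIP OF THE JET DATUM**: if `σ₀ (wm m) = σ₀ m` («`σ^w = σ`») and `λ(wm m) = −λ(m)` («`λ^w = −λ`») for a self-map `wm` of `M`, then the lower-triangular
jets satisfy `N₀ (wm m) = N₀' m` — «`(σ ⊗ [[1,0],[λ,1]])^w = σ ⊗ [[1,0],[−λ,1]]`».  At `G = U(Φ₃)(L⁺_v)`, `wm = Ad(w₀)` on the diagonal torus: the K4′ datum
(`χ^w = χ`, the occurring additive character `λ = c·ord` flips sign). [cite: Keys1984, §3 pp. 118–119] [cite: Rogawski1990, §12.2 (3) p. 173] -/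
theorem unipotentModel_apply_weylConj_eq (wm : M → M) (hσw : ∀ m, σ₀ (wm m) = σ₀ m) (hlamw : ∀ m, lam (wm m) = -lam m) (m : M) :
    N₀ (wm m) = N₀' m := by
  refine LinearMap.ext fun w => ?_
  rw [hN₀, hN₀', hσw, hlamw]

end Flip

section FlipChar

variable {M : Type*} [Group M] (χ : M →* ℂ) (χ₁ : Representation ℂ M ℂ) (hχ₁ : ∀ (m : M) (x : ℂ), χ₁ m x = χ m * x)
  (lam : M → ℂ) (N₀ N₀' : Representation ℂ M (ℂ × ℂ))
  (hN₀ : ∀ (m : M) (w : ℂ × ℂ), N₀ m w = (χ₁ m w.1, lam m • χ₁ m w.1 + χ₁ m w.2))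
  (hN₀' : ∀ (m : M) (w : ℂ × ℂ), N₀' m w = (χ₁ m w.1, (-lam m) • χ₁ m w.1 + χ₁ m w.2))

include hχ₁ in
/-- `χ (wm m) = χ m` for all `m` gives `χ₁ (wm m) = χ₁ m` for the character representation `χ₁ m x = χ(m)·x` (the `hGL` TEXT's `χ χ₁ hχ₁`). [cite: Rogawski1990, §12.2 (3) p. 173] -/
theorem charRep_apply_weylConj_eq (wm : M → M) (hχw : ∀ m, χ (wm m) = χ m) (m : M) : χ₁ (wm m) = χ₁ m := by
  refine LinearMap.ext fun x => ?_
  rw [hχ₁, hχ₁, hχw]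

include hχ₁ hN₀ hN₀' in
/-- **THE WEYL FLIP, CHARACTER SPELLING** (the (O1) head's `hGL` letters `χ χ₁ hχ₁ lam N₀ N₀' hN₀ hN₀'`): `χ(wm m) = χ(m)` and `λ(wm m) = −λ(m)` give `N₀ (wm m) = N₀' m`.
[cite: Keys1984, §3 pp. 118–119] [cite: Rogawski1990, §12.2 (3) p. 173] -/
theorem unipotentModel_char_apply_weylConj_eq (wm : M → M) (hχw : ∀ m, χ (wm m) = χ m) (hlamw : ∀ m, lam (wm m) = -lam m) (m : M) :
    N₀ (wm m) = N₀' m :=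
  unipotentModel_apply_weylConj_eq χ₁ lam N₀ N₀' hN₀ hN₀' wm (charRep_apply_weylConj_eq χ χ₁ hχ₁ wm hχw) hlamw m

end FlipChar

/-! ## §2 The open fixer of the jet's inducing datum (any parabolic triple) -/

section Fixer

variable {G : Type*} [Group G] [TopologicalSpace G] [IsTopologicalGroup G] (t : ParabolicTriple G) [LocallyCompactSpace ↥t.P]
  {W : Type*} [AddCommGroup W] [Module ℂ W]
  (σ₀ : Representation ℂ ↥t.M W) (lam : ↥t.M → ℂ) (N₀ : Representation ℂ ↥t.M (W × W))
  (hN₀ : ∀ (m : ↥t.M) (w : W × W), N₀ m w = (σ₀ m w.1, lam m • σ₀ m w.1 + σ₀ m w.2))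

include hN₀ in
/-- **OPEN FIXER OF THE JET DATUM**: if `σ₀ ∘ proj ⊗ δ_P^{1∕2}` fixes `w₁` and `w₂` on `P ∩ K₁` and `λ ∘ proj` vanishes on `P ∩ K₂` for open subgroups `K₁, K₂ ≤ G`, then the inducing
datum `N₀ ∘ proj ⊗ δ_P^{1∕2}` of `i_P(N₀)` fixes `(w₁, w₂)` on `P ∩ (K₁ ⊓ K₂)` (★ J2 `twist_comp_proj_unipotentModel_apply`).  This is the per-vector smoothness hypothesis `hσ` of
FILE B `F0P3U3PrincipalSeriesOpenCellSigmaTwist` (B2) at `σ := N₀`. [cite: BernsteinZelevinsky1977, §2.3] [cite: Casselman1995, §6.3] -/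
theorem exists_isOpen_forall_twist_unipotentModel_apply_eq (w : W × W)
    (hσK : ∃ K : Subgroup G, IsOpen (K : Set G) ∧ ∀ b : ↥t.P, (b : G) ∈ K →
      Representation.twist (σ₀.comp t.proj) (rootDeltaChar t.P) b w.1 = w.1 ∧ Representation.twist (σ₀.comp t.proj) (rootDeltaChar t.P) b w.2 = w.2)
    (hlamK : ∃ K : Subgroup G, IsOpen (K : Set G) ∧ ∀ b : ↥t.P, (b : G) ∈ K → lam (t.proj b) = 0) :
    ∃ K : Subgroup G, IsOpen (K : Set G) ∧ ∀ b : ↥t.P, (b : G) ∈ K → Representation.twist (N₀.comp t.proj) (rootDeltaChar t.P) b w = w := by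
  obtain ⟨K₁, hK₁o, hK₁⟩ := hσK
  obtain ⟨K₂, hK₂o, hK₂⟩ := hlamK
  refine ⟨K₁ ⊓ K₂, hK₁o.inter hK₂o, fun b hb => ?_⟩
  obtain ⟨h1, h2⟩ := hK₁ b hb.1
  rw [twist_comp_proj_unipotentModel_apply t σ₀ lam N₀ hN₀ b w, h1, h2, hK₂ b hb.2, zero_smul, zero_add]

end Fixer

section LamFixer

variable {G : Type*} [Group G] [TopologicalSpace G] [NonarchimedeanGroup G] (t : ParabolicTriple G) (lam : ↥t.M → ℂ)

/-- **`λ ∘ proj` VANISHES NEAR `1`** whenever `λ` vanishes on an open subgroup `K_M` of `M`, `proj : P → M` is continuous and `G` is non-archimedean: some open subgroup `K ≤ G` has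
`λ (proj b) = 0` for all `b ∈ P ∩ K` (`proj⁻¹ K_M` is open in `P`, hence the trace of an open set of `G` containing `1`, which contains an open subgroup).  Every additive character
OCCURRING in a smooth Jacquet module vanishes on an open subgroup. [cite: BernsteinZelevinsky1977, §1.9 and §2.3] -/
theorem exists_isOpen_forall_lam_proj_eq_zero (hproj : Continuous t.proj)
    (hlam : ∃ KM : Subgroup ↥t.M, IsOpen (KM : Set ↥t.M) ∧ ∀ m ∈ KM, lam m = 0) :
    ∃ K : Subgroup G, IsOpen (K : Set G) ∧ ∀ b : ↥t.P, (b : G) ∈ K → lam (t.proj b) = 0 := by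
  obtain ⟨KM, hKMo, hKM⟩ := hlam
  -- `proj⁻¹ K_M` is open in `P` and contains `1`
  have hU : IsOpen ((t.proj) ⁻¹' (KM : Set ↥t.M)) := hKMo.preimage hproj
  -- it is the trace on `P` of an open set of `G`
  obtain ⟨O, hOo, hO⟩ := isOpen_induced_iff.1 hU
  have h1O : (1 : G) ∈ O := by
    have : (1 : ↥t.P) ∈ Subtype.val ⁻¹' O := by
      rw [hO]; exact Set.mem_preimage.2 (by rw [map_one]; exact KM.one_mem)
    exact this
  -- an open subgroup inside `O`
  obtain ⟨K, hK⟩ := NonarchimedeanGroup.is_nonarchimedean O (hOo.mem_nhds h1O)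
  refine ⟨(K : Subgroup G), K.isOpen, fun b hb => hKM _ ?_⟩
  have hb' : b ∈ Subtype.val ⁻¹' O := hK hb
  rw [hO] at hb'
  exact hb'

end LamFixer

/-! ## §3 The CM datum `U(Φ₃)(L⁺_v)`: the character's open fixer, the `λ`-fixer, the assembled `hσ`, and the Weyl flip at `Ad(w₀)` -/

section Datum

variable (L : Type) [Field L] [NumberField L] [IsCMField L] (v : HeightOneSpectrum (𝓞 ↥(maximalRealSubfield L)))

set_option synthInstance.maxHeartbeats 400000 in
/-- **`hσK` AT THE DATUM for a CONTINUOUS character `χ` of `T(L⁺_v)`**: an open subgroup `K ≤ U(Φ₃)(L⁺_v)` on whose trace `B ∩ K` the inducing character `χ∘proj ⊗ δ_B^{1∕2}` is trivial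
(★ (L-q) §6 `exists_isOpen_forall_twist_comp_proj_eq_one`: `B` closed ★ `isClosed_borelU`, `K_v` compact open ★ `isCompact_isOpen_cmLocalIntegralLevel`, `G` non-archimedean ★
`nonarchimedeanGroup_cmLocal`), read for the CHARACTER REPRESENTATION `χ₁ m x = χ(m)·x` of the `hGL` TEXT, coordinatewise on `ℂ × ℂ`. [cite: BernsteinZelevinsky1977, §2.3] [cite: Casselman1995, §6.3] -/
theorem exists_isOpen_forall_twist_charRep_apply_eq_cm (χ : ↥(cmBorelTriple L 3 v).M →* ℂˣ)
    (hχ : Continuous fun x => ((χ x : ℂˣ) : ℂ))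
    (χ₁ : Representation ℂ ↥(cmBorelTriple L 3 v).M ℂ) (hχ₁ : ∀ (m : ↥(cmBorelTriple L 3 v).M) (x : ℂ), χ₁ m x = (χ m : ℂ) * x) (w : ℂ × ℂ) :
    haveI := locallyCompactSpace_cmBorelU L 3 v
    ∃ K : Subgroup ↥(unitaryGroupOfForm (conjLocal L (IsCMField.complexConj L) v) (cmLocalForm L 3 v)),
      IsOpen (K : Set ↥(unitaryGroupOfForm (conjLocal L (IsCMField.complexConj L) v) (cmLocalForm L 3 v))) ∧
      ∀ b : ↥(cmBorelTriple L 3 v).P, (b : ↥(unitaryGroupOfForm (conjLocal L (IsCMField.complexConj L) v) (cmLocalForm L 3 v))) ∈ K →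
        Representation.twist (χ₁.comp (cmBorelTriple L 3 v).proj) (rootDeltaChar (cmBorelTriple L 3 v).P) b w.1 = w.1 ∧
          Representation.twist (χ₁.comp (cmBorelTriple L 3 v).proj) (rootDeltaChar (cmBorelTriple L 3 v).P) b w.2 = w.2 := by
  haveI := locallyCompactSpace_cmBorelU L 3 v
  haveI := nonarchimedeanGroup_cmLocal L 3 v
  have hK := isCompact_isOpen_cmLocalIntegralLevel L 3 (Matrix.of fun i j : Fin 3 => if i.val + j.val + 1 = 3 then (1 : L) else 0) v
  obtain ⟨K, hKo, hKfix⟩ := (cmBorelTriple L 3 v).exists_isOpen_forall_twist_comp_proj_eq_one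
    (isClosed_borelU (conjLocal L (IsCMField.complexConj L) v) (cmLocalForm L 3 v)) hK.2 hK.1 χ
    (continuous_apply_proj_borelTriple (conjLocal L (IsCMField.complexConj L) v) (cmLocalForm L 3 v) (cmLocalForm_eq_over L 3 v) χ hχ)
  -- the character representation `χ₁` IS `(trivial ⊗ χ)` pointwise
  have hχ₁' : ∀ (b : ↥(cmBorelTriple L 3 v).P) (x : ℂ),
      Representation.twist (χ₁.comp (cmBorelTriple L 3 v).proj) (rootDeltaChar (cmBorelTriple L 3 v).P) b x =
        Representation.twist (((Representation.trivial ℂ ↥(cmBorelTriple L 3 v).M ℂ).twist χ).comp (cmBorelTriple L 3 v).proj)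
          (rootDeltaChar (cmBorelTriple L 3 v).P) b x := by
    intro b x
    simp only [Representation.twist_apply, MonoidHom.coe_comp, Function.comp_apply, hχ₁, Representation.trivial_apply, smul_eq_mul]
  refine ⟨K, hKo, fun b hb => ⟨?_, ?_⟩⟩
  · rw [hχ₁', hKfix b hb]
  · rw [hχ₁', hKfix b hb]

/-- **`hlamK` AT THE DATUM**: an additive-type `λ : T(L⁺_v) → ℂ` vanishing on an open subgroup of the torus vanishes on `proj (B ∩ K)` for some open subgroup `K ≤ U(Φ₃)(L⁺_v)`
(§2 `exists_isOpen_forall_lam_proj_eq_zero` with ★ `continuous_proj_borelTriple`, ★ `nonarchimedeanGroup_cmLocal`). [cite: BernsteinZelevinsky1977, §1.9 and §2.3] -/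
theorem exists_isOpen_forall_lam_proj_eq_zero_cm (lam : ↥(cmBorelTriple L 3 v).M → ℂ)
    (hlam : ∃ KM : Subgroup ↥(cmBorelTriple L 3 v).M, IsOpen (KM : Set ↥(cmBorelTriple L 3 v).M) ∧ ∀ m ∈ KM, lam m = 0) :
    haveI := locallyCompactSpace_cmBorelU L 3 v
    ∃ K : Subgroup ↥(unitaryGroupOfForm (conjLocal L (IsCMField.complexConj L) v) (cmLocalForm L 3 v)),
      IsOpen (K : Set ↥(unitaryGroupOfForm (conjLocal L (IsCMField.complexConj L) v) (cmLocalForm L 3 v))) ∧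
      ∀ b : ↥(cmBorelTriple L 3 v).P, (b : ↥(unitaryGroupOfForm (conjLocal L (IsCMField.complexConj L) v) (cmLocalForm L 3 v))) ∈ K →
        lam ((cmBorelTriple L 3 v).proj b) = 0 := by
  haveI := nonarchimedeanGroup_cmLocal L 3 v
  exact exists_isOpen_forall_lam_proj_eq_zero (cmBorelTriple L 3 v) lam
    (continuous_proj_borelTriple (conjLocal L (IsCMField.complexConj L) v) (cmLocalForm L 3 v) (cmLocalForm_eq_over L 3 v)) hlam

set_option synthInstance.maxHeartbeats 400000 in
/-- **THE OPEN FIXER OF THE JET DATUM `i_B(χ ⊗ [[1,0],[λ,1]])` AT `U(Φ₃)(L⁺_v)` — FILE B (B2)'s `hσ` at `σ := N₀`, every `w : ℂ × ℂ`**: for a CONTINUOUS character `χ` of `T(L⁺_v)`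
(read as `χ₁ m x = χ(m)·x`), an additive-type `λ` vanishing on an open subgroup of `T` (every `λ` OCCURRING in a smooth Jacquet module does), and the jet `N₀` of `(χ₁, λ)`
(★ J2 letters `hN₀`), the inducing datum `N₀ ∘ proj ⊗ δ_B^{1∕2}` fixes `w` on `B ∩ K` for some open subgroup `K`. [cite: BernsteinZelevinsky1977, §2.3] [cite: Casselman1995, §6.3]
[cite: Keys1984, §3 pp. 118–119] -/
theorem exists_isOpen_forall_twist_unipotentModel_char_apply_eq_cm (χ : ↥(cmBorelTriple L 3 v).M →* ℂˣ)
    (hχ : Continuous fun x => ((χ x : ℂˣ) : ℂ))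
    (χ₁ : Representation ℂ ↥(cmBorelTriple L 3 v).M ℂ) (hχ₁ : ∀ (m : ↥(cmBorelTriple L 3 v).M) (x : ℂ), χ₁ m x = (χ m : ℂ) * x)
    (lam : ↥(cmBorelTriple L 3 v).M → ℂ)
    (hlam : ∃ KM : Subgroup ↥(cmBorelTriple L 3 v).M, IsOpen (KM : Set ↥(cmBorelTriple L 3 v).M) ∧ ∀ m ∈ KM, lam m = 0)
    (N₀ : Representation ℂ ↥(cmBorelTriple L 3 v).M (ℂ × ℂ))
    (hN₀ : ∀ (m : ↥(cmBorelTriple L 3 v).M) (w : ℂ × ℂ), N₀ m w = (χ₁ m w.1, lam m • χ₁ m w.1 + χ₁ m w.2)) (w : ℂ × ℂ) :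
    haveI := locallyCompactSpace_cmBorelU L 3 v
    ∃ K : Subgroup ↥(unitaryGroupOfForm (conjLocal L (IsCMField.complexConj L) v) (cmLocalForm L 3 v)),
      IsOpen (K : Set ↥(unitaryGroupOfForm (conjLocal L (IsCMField.complexConj L) v) (cmLocalForm L 3 v))) ∧
      ∀ b : ↥(cmBorelTriple L 3 v).P, (b : ↥(unitaryGroupOfForm (conjLocal L (IsCMField.complexConj L) v) (cmLocalForm L 3 v))) ∈ K →
        Representation.twist (N₀.comp (cmBorelTriple L 3 v).proj) (rootDeltaChar (cmBorelTriple L 3 v).P) b w = w := by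
  haveI := locallyCompactSpace_cmBorelU L 3 v
  exact exists_isOpen_forall_twist_unipotentModel_apply_eq (cmBorelTriple L 3 v) χ₁ lam N₀ hN₀ w
    (exists_isOpen_forall_twist_charRep_apply_eq_cm L v χ hχ χ₁ hχ₁ w) (exists_isOpen_forall_lam_proj_eq_zero_cm L v lam hlam)

/-- **THE WEYL FLIP AT `Ad(w₀)` ON THE DIAGONAL TORUS OF `U(Φ₃)(L⁺_v)`** (`w₀` of matrix `Φ₃`, ★ F1; `ʷm := w₀ m w₀⁻¹ ∈ T` by ★ T3b `weylConj_mem_cmTorus` — the spelling of FILE B (B2)'s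
`σ(ʷm)`): `χ(ʷm) = χ(m)` («`χ^w = χ`», the K4′ datum [Rogawski1990 §12.2 (3)]) and `λ(ʷm) = −λ(m)` (rank one: an occurring additive `λ` is `c·ord`, and `Ad(w₀)` inverts the split
torus) give `N₀ ⟨w₀ m w₀⁻¹, _⟩ = N₀' m` — FILE B (B2) at `σ := N₀` then reads `θ (r(m) x) = N₀' m (θ x)`, the (O1) head's `hθM`. [cite: Keys1984, §3 pp. 118–119] [cite: Rogawski1990, §12.2 (3) p. 173] -/
theorem unipotentModel_char_apply_cmWeylConj_eq
    (w₀ : ↥(unitaryGroupOfForm (conjLocal L (IsCMField.complexConj L) v) (cmLocalForm L 3 v)))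
    (hw₀ : Units.val (w₀ : GL (Fin 3) (LocalRing L v)) = cmLocalForm L 3 v)
    (χ : ↥(cmBorelTriple L 3 v).M →* ℂ) (χ₁ : Representation ℂ ↥(cmBorelTriple L 3 v).M ℂ) (hχ₁ : ∀ (m : ↥(cmBorelTriple L 3 v).M) (x : ℂ), χ₁ m x = χ m * x)
    (lam : ↥(cmBorelTriple L 3 v).M → ℂ) (N₀ N₀' : Representation ℂ ↥(cmBorelTriple L 3 v).M (ℂ × ℂ))
    (hN₀ : ∀ (m : ↥(cmBorelTriple L 3 v).M) (w : ℂ × ℂ), N₀ m w = (χ₁ m w.1, lam m • χ₁ m w.1 + χ₁ m w.2))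
    (hN₀' : ∀ (m : ↥(cmBorelTriple L 3 v).M) (w : ℂ × ℂ), N₀' m w = (χ₁ m w.1, (-lam m) • χ₁ m w.1 + χ₁ m w.2))
    (hχw : ∀ m : ↥(cmBorelTriple L 3 v).M,
      χ ⟨w₀ * (m : ↥(unitaryGroupOfForm (conjLocal L (IsCMField.complexConj L) v) (cmLocalForm L 3 v))) * w₀⁻¹, weylConj_mem_cmTorus L v w₀ hw₀ m⟩ = χ m)
    (hlamw : ∀ m : ↥(cmBorelTriple L 3 v).M,
      lam ⟨w₀ * (m : ↥(unitaryGroupOfForm (conjLocal L (IsCMField.complexConj L) v) (cmLocalForm L 3 v))) * w₀⁻¹, weylConj_mem_cmTorus L v w₀ hw₀ m⟩ = -lam m)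
    (m : ↥(cmBorelTriple L 3 v).M) :
    N₀ ⟨w₀ * (m : ↥(unitaryGroupOfForm (conjLocal L (IsCMField.complexConj L) v) (cmLocalForm L 3 v))) * w₀⁻¹, weylConj_mem_cmTorus L v w₀ hw₀ m⟩ = N₀' m :=
  unipotentModel_char_apply_weylConj_eq χ χ₁ hχ₁ lam N₀ N₀' hN₀ hN₀'
    (fun m => ⟨w₀ * (m : ↥(unitaryGroupOfForm (conjLocal L (IsCMField.complexConj L) v) (cmLocalForm L 3 v))) * w₀⁻¹, weylConj_mem_cmTorus L v w₀ hw₀ m⟩) hχw hlamw m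

end Datum

end Summit.HodgeConjecture.HodgeConjecture.Cruxes.H413.F0P3cStCharTSJetDatumWeylDock

end
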